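import Mathlib

/-!
# A2Correspondence — the Gysin / Pontryagin bookkeeping of sub-claim A2

Kernel-checked form of the formal part of route/T4-A2-p6.md, (A4.1.1), (A4.1.3), (A4.3.3) and
Prop. A4.4.1 (cell pub-hodge-repro2, Tier 4, sub-claim A2 = the Lefschetz (1,1) + Gysin step).

The four commutative rings stand for the EVEN-degree cohomology rings `H^{ev}(S)`, `H^{ev}(B)`,
`H^{ev}(B × B)`, `H^{ev}(S × B)` (the cup product is graded-commutative, so the even-degree part is a
commutative ring; every class of (S1)–(S4) — `1_S`, `z`, `θ`, `θ^4`, `ζ`, `γ`, `y` — has even degree).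
The maps are the pull-backs (ring homomorphisms, (F3)) and the Gysin push-forwards (additive maps,
Definition A4.1.0) of the diagram

  `f : S → B`,  `pr_1, pr_2, m : B × B → B`,  `φ = (pr_2, m) : B × B → B × B`,
  `f × id : S × B → B × B`,  `pr_B = pr_2 ∘ (f × id) : S × B → B`,  `h = m ∘ (f × id) : S × B → B`,

and the structure records EXACTLY the identities the proofs of the section use: the projection formula
`g_*(α · g^*v) = g_*(α) · v` for `g = f, φ, f × id` (Lemma A4.1.1(i)), the functoriality identities
`(pr_2 ∘ φ)_* = pr_{2*} ∘ φ_* = m_*` and `h_* = m_* ∘ (f × id)_*`, the pull-back identities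
`φ^* ∘ pr_1^* = pr_2^*` (from `pr_1 ∘ φ = pr_2`) and `(f × id)^* ∘ pr_2^* = pr_B^*`, and the
cross-product compatibility `(f × id)_*(1) = pr_1^*(f_*(1))` (Step 1 of Prop. A4.4.1(i), which in the
prose is Bredon's naturality of the homology cross product + Thm. VI.5.4). Everything geometric is a
field of the structure; the theorems below are the algebra that the section calls [P].

Honest scope: the rings, maps and identities are DATA here — singular cohomology, Poincaré duality and
Fulton's cycle class are not constructed (Mathlib has none of them). The file proves that, given the
listed identities, `y = h_*(ζ^4)`, `T_γ(u) = z ⋆ (θ^3 · u)`, `y = T_γ(θ)` (for even-degree `u`; the prose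
statement also covers odd degrees, which the commutative model does not see), `∫_B z · u = ∫_S f^*u`,
and that algebraic classes propagate: `z`, `ζ`, `γ`, `y`, `T_γ(u)` are algebraic.
-/

namespace Summit.Ventures.HodgeRepro2.A2Correspondence

universe u v w x

/-- The even-degree cohomology rings of `S`, `B`, `B × B`, `S × B` with the pull-backs, the Gysin maps
and the identities used by sub-claim A2 (see the module docstring for the dictionary). -/
structure GysinData (HS : Type u) (HB : Type v) (HBB : Type w) (HSB : Type x)
    [CommRing HS] [CommRing HB] [CommRing HBB] [CommRing HSB] where
  /-- `f^* : H(B) → H(S)`. -/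
  fPull : HB →+* HS
  /-- `f_* : H(S) → H(B)` (Gysin map of `f : S → B`, degree `+20`). -/
  fPush : HS →+ HB
  /-- `pr_1^* : H(B) → H(B × B)`. -/
  pr1Pull : HB →+* HBB
  /-- `pr_2^* : H(B) → H(B × B)`. -/
  pr2Pull : HB →+* HBB
  /-- `m_* : H(B × B) → H(B)` (Gysin map of the addition `m`, degree `−24`). -/
  mPush : HBB →+ HB
  /-- `pr_{2*} : H(B × B) → H(B)` (degree `−24`). -/
  pr2Push : HBB →+ HB
  /-- `φ^* : H(B × B) → H(B × B)` for `φ = (pr_2, m)`. -/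
  phiPull : HBB →+* HBB
  /-- `φ_* : H(B × B) → H(B × B)` (degree `0`). -/
  phiPush : HBB →+ HBB
  /-- `pr_B^* : H(B) → H(S × B)`. -/
  prBPull : HB →+* HSB
  /-- `(f × id_B)^* : H(B × B) → H(S × B)`. -/
  fidPull : HBB →+* HSB
  /-- `(f × id_B)_* : H(S × B) → H(B × B)` (degree `+20`). -/
  fidPush : HSB →+ HBB
  /-- `h_* : H(S × B) → H(B)` for `h = m ∘ (f × id_B)`, `(s, b) ↦ f(s) + b` (degree `−4`). -/
  hPush : HSB →+ HB
  /-- Projection formula for `f` (Lemma A4.1.1(i)). -/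
  proj_f : ∀ (α : HS) (v : HB), fPush (α * fPull v) = fPush α * v
  /-- Projection formula for `φ` (Lemma A4.1.1(i)). -/
  proj_phi : ∀ (α v : HBB), phiPush (α * phiPull v) = phiPush α * v
  /-- Projection formula for `f × id_B` (Lemma A4.1.1(i)). -/
  proj_fid : ∀ (α : HSB) (v : HBB), fidPush (α * fidPull v) = fidPush α * v
  /-- `pr_1 ∘ φ = pr_2`, on pull-backs. -/
  phiPull_pr1Pull : ∀ v : HB, phiPull (pr1Pull v) = pr2Pull v
  /-- `pr_2 ∘ φ = m`, on Gysin maps (functoriality, Definition A4.1.0). -/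
  pr2Push_phiPush : ∀ w : HBB, pr2Push (phiPush w) = mPush w
  /-- `pr_B = pr_2 ∘ (f × id_B)`, on pull-backs. -/
  fidPull_pr2Pull : ∀ v : HB, fidPull (pr2Pull v) = prBPull v
  /-- `h = m ∘ (f × id_B)`, on Gysin maps (functoriality). -/
  hPush_eq : ∀ w : HSB, hPush w = mPush (fidPush w)
  /-- Step 1 of Prop. A4.4.1(i): `(f × id_B)_*(1_{S × B}) = pr_1^*(f_*(1_S))` (cross-product
  naturality, Bredon Thm. VI.1.2 / Thm. VI.5.4 in the prose). -/
  fidPush_one : fidPush 1 = pr1Pull (fPush 1)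

namespace GysinData

variable {HS : Type u} {HB : Type v} {HBB : Type w} {HSB : Type x}
  [CommRing HS] [CommRing HB] [CommRing HBB] [CommRing HSB]
  (D : GysinData HS HB HBB HSB)

/-- `z := f_*(1_S) ∈ H^{20}(B)` (A4.1.3). -/
def z : HB := D.fPush 1

/-- The Pontryagin product `a ⋆ b := m_*(pr_1^*a · pr_2^*b)` (A4.3.3). -/
def pont (a b : HB) : HB := D.mPush (D.pr1Pull a * D.pr2Pull b)

/-- `y := z ⋆ θ^4 ∈ H^4(B)` (A4.3.3, Definition). -/
def y (θ : HB) : HB := D.pont D.z (θ ^ 4)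

/-- `ζ := pr_B^* θ ∈ H^2(S × B)` (Prop. A4.4.1(i)). -/
def zeta (θ : HB) : HSB := D.prBPull θ

/-- `γ := φ_*(pr_1^* z · pr_2^* θ^3) ∈ H^{26}(B × B)` (Prop. A4.4.1(ii)). -/
def gamma (θ : HB) : HBB := D.phiPush (D.pr1Pull D.z * D.pr2Pull (θ ^ 3))

/-- The correspondence `T_γ(u) := pr_{2*}(γ · pr_1^* u)` (Prop. A4.4.1(ii)), even-degree `u`. -/
def T (θ u : HB) : HB := D.pr2Push (D.gamma θ * D.pr1Pull u)

/-- Steps 1–2 of Prop. A4.4.1(i): `(f × id_B)_*(pr_B^* v) = pr_1^* z · pr_2^* v`. -/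
theorem fidPush_prBPull (v : HB) :
    D.fidPush (D.prBPull v) = D.pr1Pull D.z * D.pr2Pull v := by
  rw [← D.fidPull_pr2Pull, ← one_mul (D.fidPull _), D.proj_fid, D.fidPush_one]
  rfl

/-- Prop. A4.4.1(i): `y = h_*(ζ^4)` — `y` is the Gysin push-forward, along the Albanese-type sum map
`h : S × B → B`, of the fourth power of the (1,1)-class `ζ = pr_B^* θ`. -/
theorem hPush_zeta_pow_four (θ : HB) : D.hPush (D.zeta θ ^ 4) = D.y θ := by
  rw [D.hPush_eq, zeta, ← map_pow, D.fidPush_prBPull]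
  rfl

/-- Prop. A4.4.1(ii), first identity: `T_γ(u) = z ⋆ (θ^3 · u)` (even-degree `u`). -/
theorem T_eq_pont (θ u : HB) : D.T θ u = D.pont D.z (θ ^ 3 * u) := by
  unfold T gamma pont
  rw [← D.proj_phi, D.phiPull_pr1Pull, mul_assoc, ← map_mul, D.pr2Push_phiPush]

/-- Prop. A4.4.1(ii), second identity: `y = T_γ(θ)` — `y` is the image of the (1,1)-class `θ` under
the correspondence `γ` built from the surface. -/
theorem T_theta (θ : HB) : D.T θ θ = D.y θ := by
  rw [D.T_eq_pont, y, ← pow_succ]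

/-- (A4.1.1) `∫_B z · u = ∫_S f^* u`: for additive "integration" maps `∫_S`, `∫_B` with
`∫_B ∘ f_* = ∫_S` (naturality of the augmentation, Lemma A4.1.1(ii)), the class `z = f_*(1)`
represents `u ↦ ∫_S f^*u`. -/
theorem int_z_mul {R : Type*} [AddCommMonoid R] (intS : HS →+ R) (intB : HB →+ R)
    (hint : ∀ α : HS, intB (D.fPush α) = intS α) (u : HB) :
    intB (D.z * u) = intS (D.fPull u) := by
  rw [z, ← D.proj_f, hint, one_mul]

/-- The algebraic classes of the four spaces (Alg^*(X) of A2.0: a subring — it contains `1`, which is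
(F5) `1_S = cl^S([S])`, and is closed under `+` and `∪` by (F3)), together with the closure hypotheses of
the section: pull-backs preserve algebraic classes ((F3), contravariance) and Gysin maps preserve
algebraic classes (Lemma A4.1.2). -/
structure AlgClasses where
  /-- `Alg^*(S)`. -/
  AS : Subring HS
  /-- `Alg^*(B)`. -/
  AB : Subring HB
  /-- `Alg^*(B × B)`. -/
  ABB : Subring HBB
  /-- `Alg^*(S × B)`. -/
  ASB : Subring HSB
  /-- Lemma A4.1.2 for `f`. -/
  fPush_mem : ∀ a ∈ AS, D.fPush a ∈ AB
  /-- (F3) for `pr_1`. -/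
  pr1Pull_mem : ∀ a ∈ AB, D.pr1Pull a ∈ ABB
  /-- (F3) for `pr_2`. -/
  pr2Pull_mem : ∀ a ∈ AB, D.pr2Pull a ∈ ABB
  /-- Lemma A4.1.2 for `m`. -/
  mPush_mem : ∀ a ∈ ABB, D.mPush a ∈ AB
  /-- Lemma A4.1.2 for `pr_2`. -/
  pr2Push_mem : ∀ a ∈ ABB, D.pr2Push a ∈ AB
  /-- Lemma A4.1.2 for `φ`. -/
  phiPush_mem : ∀ a ∈ ABB, D.phiPush a ∈ ABB
  /-- (F3) for `pr_B`. -/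
  prBPull_mem : ∀ a ∈ AB, D.prBPull a ∈ ASB

namespace AlgClasses

variable {D} (A : D.AlgClasses)

/-- (A4.1.3): `z = f_*(1_S)` is algebraic (`1_S` is algebraic by (F5), Lemma A4.1.2 for `f`). -/
theorem z_mem : D.z ∈ A.AB := A.fPush_mem 1 A.AS.one_mem

/-- (A4.3.3): the Pontryagin product of algebraic classes is algebraic (Lemma A4.3.2 + Lemma A4.1.2). -/
theorem pont_mem {a b : HB} (ha : a ∈ A.AB) (hb : b ∈ A.AB) : D.pont a b ∈ A.AB :=
  A.mPush_mem _ (A.ABB.mul_mem (A.pr1Pull_mem a ha) (A.pr2Pull_mem b hb))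

/-- (S3): `y = z ⋆ θ^4` is algebraic when `θ` is. -/
theorem y_mem {θ : HB} (hθ : θ ∈ A.AB) : D.y θ ∈ A.AB :=
  A.pont_mem A.z_mem (A.AB.pow_mem hθ 4)

/-- (S4)(i): `ζ = pr_B^* θ` is algebraic when `θ` is ((F3) for `pr_B`). -/
theorem zeta_mem {θ : HB} (hθ : θ ∈ A.AB) : D.zeta θ ∈ A.ASB := A.prBPull_mem θ hθ

/-- (S4)(ii): the correspondence `γ = φ_*(pr_1^* z · pr_2^* θ^3)` is algebraic when `θ` is. -/
theorem gamma_mem {θ : HB} (hθ : θ ∈ A.AB) : D.gamma θ ∈ A.ABB :=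
  A.phiPush_mem _ (A.ABB.mul_mem (A.pr1Pull_mem _ A.z_mem) (A.pr2Pull_mem _ (A.AB.pow_mem hθ 3)))

/-- (S4)(ii): `T_γ` maps algebraic classes to algebraic classes. -/
theorem T_mem {θ u : HB} (hθ : θ ∈ A.AB) (hu : u ∈ A.AB) : D.T θ u ∈ A.AB :=
  A.pr2Push_mem _ (A.ABB.mul_mem (A.gamma_mem hθ) (A.pr1Pull_mem u hu))

/-- (S1), (S3), (S4) of sub-claim A2 in the abstract formalism, packaged: for an algebraic class `θ`,
`z` is algebraic and represents `u ↦ ∫_S f^*u`; `y = z ⋆ θ^4` is algebraic; `ζ = pr_B^* θ` is algebraic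
and `y = h_*(ζ^4)`; the correspondence `γ` is algebraic and `y = T_γ(θ)`. -/
theorem summary {R : Type*} [AddCommMonoid R] (intS : HS →+ R) (intB : HB →+ R)
    (hint : ∀ α : HS, intB (D.fPush α) = intS α) {θ : HB} (hθ : θ ∈ A.AB) :
    D.z ∈ A.AB ∧ (∀ u, intB (D.z * u) = intS (D.fPull u)) ∧
      D.y θ ∈ A.AB ∧ D.zeta θ ∈ A.ASB ∧ D.hPush (D.zeta θ ^ 4) = D.y θ ∧
      D.gamma θ ∈ A.ABB ∧ D.T θ θ = D.y θ :=
  ⟨A.z_mem, fun u => D.int_z_mul intS intB hint u, A.y_mem hθ, A.zeta_mem hθ,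
    D.hPush_zeta_pow_four θ, A.gamma_mem hθ, D.T_theta θ⟩

end AlgClasses

end GysinData

end Summit.Ventures.HodgeRepro2.A2Correspondence
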